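import Literature.Computability.Complexity.HiraharaMachinePre
import HarnessLib

/-!
# The machine of Hirahara's reduction, II: the parameters on tuples

Topic `Computability/Complexity`. The numeric parameters of the reduction (`HiraharaInstance.lean`,
`PInst.Δ, lam, Lj, kA, N, mI, ℓ, dNW, Nbig, sP`, the coin offsets `PInst.off` of
`HiraharaSpec.lean`) as functions of the instance tuple, each proved equal to the parameter of
`Pre.toPInst I₀` on `I₀.toTuple` (for a weight list of length `n`) and computed on codes.

## References

* S. Hirahara, *NP-hardness of learning programs and partial MCSP*, ECCC TR22-119, proofs of
  Lemma 8.3 and Thm. 8.5 [Hirahara2022PartialMCSP].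
* S. Arora, B. Barak, *Computational Complexity: A Modern Approach*, CUP 2009, §1.2–1.3.
-/

namespace Literature.Computability.Complexity

open Finset
open _root_.Computability Polynomial
open Literature.Computability.MetaComplexity (MonotoneDNF sqrtLog CMMSAInstance)
open CSPToCMMSAMachine (TO toE)
open CodeFP

namespace HiraharaMachine

/-! ### Maxima over lists versus finite suprema -/

/-- `foldr max 0` dominates every item (local copy of a folklore helper). [folklore] -/
private theorem le_foldr_max_of_mem {l : List ℕ} {x : ℕ} (h : x ∈ l) : x ≤ l.foldr max 0 := by
  induction l with
  | nil => simp at h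
  | cons a l ih =>
    rw [List.foldr_cons]
    rcases List.mem_cons.1 h with rfl | h
    · exact le_max_left _ _
    · exact (ih h).trans (le_max_right _ _)

/-- `foldr max 0 ≤ M` when every item is `≤ M` (local copy of a folklore helper). [folklore] -/
private theorem foldr_max_le {l : List ℕ} {M : ℕ} (h : ∀ x ∈ l, x ≤ M) : l.foldr max 0 ≤ M := by
  induction l with
  | nil => simp
  | cons a l ih =>
    rw [List.foldr_cons]
    exact max_le (h a (List.mem_cons_self ..)) (ih fun x hx => h x (List.mem_cons_of_mem _ hx))

/-- A finite supremum over `Fin n` as a list maximum. [folklore] -/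
theorem sup_univ_eq_foldr {n : ℕ} (f : Fin n → ℕ) (g : ℕ → ℕ) (hfg : ∀ k : Fin n, f k = g k) :
    (univ : Finset (Fin n)).sup f = ((List.range n).map g).foldr max 0 := by
  apply le_antisymm
  · refine Finset.sup_le fun k _ => ?_
    rw [hfg]
    exact le_foldr_max_of_mem (List.mem_map.2 ⟨k, List.mem_range.2 k.isLt, rfl⟩)
  · refine foldr_max_le fun x hx => ?_
    obtain ⟨k, hk, rfl⟩ := List.mem_map.1 hx
    rw [List.mem_range] at hk
    rw [← hfg ⟨k, hk⟩]
    exact Finset.le_sup (f := f) (mem_univ _)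

/-! ### The parameters on tuples -/

section Params

variable (t : TO)

/-- `n` read as the length of the weight list. [folklore] -/
def nT : ℕ := t.2.2.1.length

/-- `ν`: the number of kept formulas. [folklore] -/
def νT : ℕ := (keptT t).length

/-- The size measure `n + m + W`. [folklore] -/
def sizeOfT : ℕ := t.2.2.1.length + t.2.1.length + t.2.2.1.sum

/-- `Λ = 4(⌊log₂ size⌋ + 1) + 4096`. [cite: Hirahara2022PartialMCSP, proof of Lemma 8.3 (choice of λ)] -/
def logLamT : ℕ := 4 * (Nat.log 2 (sizeOfT t) + 1) + 4096

/-- `λ = 2^Λ`. [cite: Hirahara2022PartialMCSP, proof of Lemma 8.3] -/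
def lamT : ℕ := 2 ^ logLamT t

/-- `Lj = ⌊log₂ ν⌋ + 1`. [folklore] -/
def LjT : ℕ := Nat.log 2 (νT t) + 1

/-- `k_A = 96 Δ²`. [cite: Hirahara2022PartialMCSP, proof of Lemma 8.1] -/
def kAT : ℕ := 96 * (ΔT t * ΔT t)

/-- `m = ⌊log₂ k_A⌋ + 1`. [folklore] -/
def mIT : ℕ := Nat.log 2 (kAT t) + 1

/-- `N_k = ⌊log₂ (max(1, w_k) λ)⌋ + 1` (for any `k`, weight `0` out of range). [cite: Hirahara2022PartialMCSP, proof of Lemma 8.3 (f_k : {0,1}^{log(λ w(k))} → {0,1})] -/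
def NT (k : ℕ) : ℕ := Nat.log 2 (max 1 (wT t k) * lamT t) + 1

/-- The seed length `16 N_k + ((N_k + m) + N_k)`. [cite: Hirahara2022PartialMCSP, proof of Lemma 8.3] -/
def seedLenT (k : ℕ) : ℕ := NT t k * 4 ^ 2 + ((NT t k + mIT t) + NT t k)

/-- The largest arity. [folklore] -/
def NbigT : ℕ := Nat.log 2 (max 1 (t.2.2.1.foldr max 0) * lamT t) + 1

/-- `ℓ = max_k seedLen k`, in closed form: the seed length at the largest arity (`0` without
variables). [cite: Hirahara2022PartialMCSP, proof of Lemma 8.3] -/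
def ℓT : ℕ := if nT t = 0 then 0 else NbigT t * 4 ^ 2 + ((NbigT t + mIT t) + NbigT t)

/-- `d = ℓ · 4^{140}`. [cite: Hirahara2022PartialMCSP, proof of Lemma 8.3] -/
def dNWT : ℕ := ℓT t * 4 ^ 140

/-- The threshold `s_P`. [cite: Hirahara2022PartialMCSP, proof of Thm. 8.5 (s_P)] -/
def sPT : ℕ :=
  320 * lamT t * t.2.2.2 / logLamT t + nT t * (ΔT t * kAT t * (NbigT t * (2 * mIT t + 3)) + ΔT t * (kAT t + 1)) +
    ((2 ^ (LjT t + 1) - 1) + νT t * (2 * ΔT t + 1) + (2 * νT t + 1))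

/-- The number of index bits `Lx = Lj + (d + Δ·Δ)`. [cite: Hirahara2022PartialMCSP, proof of Thm. 8.5] -/
def LxT : ℕ := LjT t + (dNWT t + ΔT t * ΔT t)

/-- The coin offset of variable `k`: `Σ_{k' < k} 2^{N_{k'}}`. [folklore] -/
def offT (k : ℕ) : ℕ := ((List.range k).map fun k' => 2 ^ NT t k').sum

end Params

/-! ### Agreement with `Pre.toPInst` -/

section Agree

variable (I₀ : CMMSAInstance) (hwf : I₀.weight.length = I₀.numVars)
include hwf

/-- `n`. [folklore] -/
theorem nT_toTuple : nT I₀.toTuple = (HiraharaRed.Pre.toPInst I₀).n := hwf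

omit hwf in
/-- `ν`. [folklore] -/
theorem νT_toTuple : νT I₀.toTuple = (HiraharaRed.Pre.toPInst I₀).ν := rfl

/-- `Δ`. [folklore] -/
theorem ΔT_toTuple : ΔT I₀.toTuple = (HiraharaRed.Pre.toPInst I₀).Δ := ΔT_eq _ hwf

/-- The size measure. [folklore] -/
theorem sizeOfT_toTuple : sizeOfT I₀.toTuple = HiraharaRed.Pre.sizeOf I₀ := by
  unfold sizeOfT HiraharaRed.Pre.sizeOf
  simp only [CMMSAInstance.toTuple]
  rw [hwf, HiraharaRed.Pre.totalW_eq_sum hwf]; rfl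

/-- `Λ`. [folklore] -/
theorem logLamT_toTuple : logLamT I₀.toTuple = (HiraharaRed.Pre.toPInst I₀).logLam := by
  change _ = HiraharaRed.Pre.logLamOf I₀
  unfold logLamT HiraharaRed.Pre.logLamOf; rw [sizeOfT_toTuple I₀ hwf]

/-- `λ`. [folklore] -/
theorem lamT_toTuple : lamT I₀.toTuple = (HiraharaRed.Pre.toPInst I₀).lam := by
  unfold lamT HiraharaRed.PInst.lam; rw [logLamT_toTuple I₀ hwf]

omit hwf in
/-- `Lj`. [folklore] -/
theorem LjT_toTuple : LjT I₀.toTuple = (HiraharaRed.Pre.toPInst I₀).Lj := rfl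

/-- `k_A`. [folklore] -/
theorem kAT_toTuple : kAT I₀.toTuple = (HiraharaRed.Pre.toPInst I₀).kA := by
  unfold kAT HiraharaRed.PInst.kA; rw [ΔT_toTuple I₀ hwf]

/-- `m`. [folklore] -/
theorem mIT_toTuple : mIT I₀.toTuple = (HiraharaRed.Pre.toPInst I₀).mI := by
  unfold mIT HiraharaRed.PInst.mI; rw [kAT_toTuple I₀ hwf]

/-- `N_k`. [folklore] -/
theorem NT_toTuple (k : Fin I₀.numVars) : NT I₀.toTuple k = (HiraharaRed.Pre.toPInst I₀).N k := by
  unfold NT HiraharaRed.PInst.N; rw [lamT_toTuple I₀ hwf]; rfl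

/-- The seed length. [folklore] -/
theorem seedLenT_toTuple (k : Fin I₀.numVars) :
    seedLenT I₀.toTuple k = (HiraharaRed.Pre.toPInst I₀).raw.seedLen k := by
  unfold seedLenT HiraharaRed.RawAmp.seedLen
  rw [NT_toTuple I₀ hwf, mIT_toTuple I₀ hwf]; rfl

/-- The weight list is the list of weights. [folklore] -/
theorem map_w_range : (List.range I₀.numVars).map (fun k => I₀.w k) = I₀.weight := by
  apply List.ext_getElem
  · simp [hwf]
  · intro i h1 h2
    simp only [List.getElem_map, List.getElem_range, CMMSAInstance.w]
    rw [List.getD_eq_getElem]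

/-- The largest weight as a list maximum. [folklore] -/
theorem sup_w_eq : (univ : Finset (Fin I₀.numVars)).sup (fun k => I₀.w k) = I₀.weight.foldr max 0 := by
  rw [sup_univ_eq_foldr _ (fun k => I₀.w k) fun k => rfl, map_w_range I₀ hwf]

/-- The largest arity. [folklore] -/
theorem NbigT_toTuple : NbigT I₀.toTuple = (HiraharaRed.Pre.toPInst I₀).Nbig := by
  unfold NbigT HiraharaRed.PInst.Nbig
  rw [lamT_toTuple I₀ hwf]
  exact congrArg (fun x => Nat.log 2 (max 1 x * _) + 1) (sup_w_eq I₀ hwf).symm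

/-- `ℓ`: the supremum of the seed lengths is the seed length at the largest arity. [folklore] -/
theorem ℓT_toTuple : ℓT I₀.toTuple = (HiraharaRed.Pre.toPInst I₀).ℓ := by
  unfold ℓT HiraharaRed.PInst.ℓ
  rw [nT_toTuple I₀ hwf, NbigT_toTuple I₀ hwf, mIT_toTuple I₀ hwf]
  set I := HiraharaRed.Pre.toPInst I₀
  rcases Nat.eq_zero_or_pos I.n with h0 | hpos
  · rw [if_pos h0]
    have : (univ : Finset (Fin I.n)) = ∅ := by
      rw [Finset.univ_eq_empty_iff]; exact ⟨fun k => absurd k.isLt (by omega)⟩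
    rw [this, Finset.sup_empty]; rfl
  · rw [if_neg hpos.ne']
    apply le_antisymm
    · haveI : Nonempty (Fin I.n) := ⟨⟨0, hpos⟩⟩
      obtain ⟨k₀, -, hk₀⟩ := Finset.exists_mem_eq_sup (univ : Finset (Fin I.n)) univ_nonempty I.w
      have hN : I.N k₀ = I.Nbig := by
        unfold HiraharaRed.PInst.N HiraharaRed.PInst.Nbig; rw [hk₀]
      calc I.Nbig * 4 ^ 2 + ((I.Nbig + I.mI) + I.Nbig) = I.raw.seedLen k₀ := by rw [← hN]; rfl
        _ ≤ univ.sup I.raw.seedLen := Finset.le_sup (f := I.raw.seedLen) (mem_univ k₀)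
    · refine Finset.sup_le fun k _ => ?_
      have := I.N_le_Nbig k
      change I.N k * 4 ^ 2 + ((I.N k + I.mI) + I.N k) ≤ _
      nlinarith

/-- `d`. [folklore] -/
theorem dNWT_toTuple : dNWT I₀.toTuple = (HiraharaRed.Pre.toPInst I₀).dNW := by
  unfold dNWT HiraharaRed.PInst.dNW; rw [ℓT_toTuple I₀ hwf]

/-- `s_P`. [folklore] -/
theorem sPT_toTuple : sPT I₀.toTuple = (HiraharaRed.Pre.toPInst I₀).sP := by
  unfold sPT HiraharaRed.PInst.sP
  rw [lamT_toTuple I₀ hwf, logLamT_toTuple I₀ hwf, nT_toTuple I₀ hwf, ΔT_toTuple I₀ hwf, kAT_toTuple I₀ hwf,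
    NbigT_toTuple I₀ hwf, mIT_toTuple I₀ hwf, LjT_toTuple, νT_toTuple]
  have : 2 ^ ((HiraharaRed.Pre.toPInst I₀).Lj + 1) - 1 = Lupanov.mintermBound (HiraharaRed.Pre.toPInst I₀).Lj := by
    have := Lupanov.mintermBound_succ_eq (HiraharaRed.Pre.toPInst I₀).Lj; omega
  rw [this]; rfl

/-- `Lx`. [folklore] -/
theorem LxT_toTuple : LxT I₀.toTuple =
    HiraharaRed.Lx (HiraharaRed.Pre.toPInst I₀).Lj (HiraharaRed.Pre.toPInst I₀).dNW (HiraharaRed.Pre.toPInst I₀).Δ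
      (HiraharaRed.Pre.toPInst I₀).Δ := by
  unfold LxT HiraharaRed.Lx; rw [LjT_toTuple, dNWT_toTuple I₀ hwf, ΔT_toTuple I₀ hwf]

/-- The coin offsets. [folklore] -/
theorem offT_toTuple (k : Fin I₀.numVars) : offT I₀.toTuple k = (HiraharaRed.Pre.toPInst I₀).off k := by
  unfold offT HiraharaRed.PInst.off
  -- both sides are `Σ_{k' < k} 2^{N k'}` over the naturals below `k`
  have hR : ∑ k' ∈ univ.filter (fun k' : Fin I₀.numVars => k' < k), 2 ^ (HiraharaRed.Pre.toPInst I₀).N k' =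
      ∑ i ∈ Finset.range k, 2 ^ NT I₀.toTuple i := by
    refine Finset.sum_nbij (fun k' : Fin I₀.numVars => k'.val) (fun k' hk' => ?_) (fun x _ y _ h => Fin.ext h)
      (fun i hi => ?_) (fun k' _ => by rw [NT_toTuple I₀ hwf])
    · exact Finset.mem_range.2 (Finset.mem_filter.1 hk').2
    · have hi' : i < k.val := Finset.mem_range.1 hi
      exact ⟨⟨i, hi'.trans k.isLt⟩, Finset.mem_filter.2 ⟨Finset.mem_univ _, hi'⟩, rfl⟩
  exact (MonotoneDNF.sum_map_range_eq_finset_sum _ _).trans hR.symm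

end Agree

/-! ### Small combinators -/

/-- Binary to unary under a computed unary cap that dominates the value. [folklore] -/
theorem unOfNatCap {α : Type} {eα : α → List Bool} {v c : α → ℕ} (hv : CodeFP eα natE v) (hc : CodeFP eα unE c)
    (h : ∀ a, v a ≤ c a) : CodeFP eα unE v :=
  (unOfNatMin.comp (hc.pair hv)).congr fun a => min_eq_left (h a)

/-- Maximum of unary numerals (local helper). [folklore] -/
private theorem unMax : CodeFP (pairE unE unE) unE (fun p => max p.1 p.2) :=
  ((unLeNat.comp ((fst unE unE).pair (natOfUn.comp (snd unE unE)))).ite (snd unE unE) (fst unE unE)).congr fun p => by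
    rcases le_or_gt p.1 p.2 with h | h
    · simp [h]
    · simp [not_le.2 h, max_eq_left h.le]

/-- Product of unary numerals (through unit budgets; local helper). [folklore] -/
private theorem unMul : CodeFP (pairE unE unE) unE (fun p => p.1 * p.2) :=
  ((ulength unitE).comp (unitsMul.comp ((replicateUnit.comp (fst unE unE)).pair (replicateUnit.comp (snd unE unE))))).congr
    fun p => by simp

/-- Sums of raw lists of binary numerals. [cite: AroraBarak2009, §1.3] -/
theorem natSum : CodeFP (rawE natE) natE List.sum := by
  have hstep : CodeFP (pairE natE natE) natE (fun t => t.2 + t.1) := (natAdd.comp ((snd _ _).pair (fst _ _)) :)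
  have hfold : ∀ (l : List ℕ) (k : ℕ), l.foldl (fun acc a => acc + a) k = k + l.sum := by
    intro l; induction l with
    | nil => intro k; simp
    | cons a l ih => intro k; rw [List.foldl_cons, ih]; simp [add_assoc]
  have h := foldl₀ (step := fun (a : ℕ) acc => acc + a) (b₀ := 0) hstep (2 * X) (fun l₁ l₂ => by
    rw [hfold, zero_add, CodeFP.length_natE, eval_mul, eval_ofNat, eval_X]
    set L := (rawE natE (l₁ ++ l₂)).length
    have hitem : ∀ x ∈ l₁, Nat.size x ≤ L := fun x hx => by
      rw [← CodeFP.length_natE]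
      have := length_item_le_length_rawE natE (List.mem_append_left l₂ hx)
      omega
    have hlen : l₁.length ≤ L := le_trans (by simp) (length_le_length_rawE natE (l₁ ++ l₂))
    have := size_sum_le (M := L) hitem
    omega)
  exact h.congr fun l => by rw [hfold, zero_add]

/-- The maximum of a raw list of unary numerals. [folklore] -/
theorem unMaxList : CodeFP (rawE unE) unE (fun l => l.foldr max 0) := by
  have hstep : CodeFP (pairE unE unE) unE (fun t => max t.2 t.1) := (unMax.comp ((snd _ _).pair (fst _ _)) :)
  have hfold : ∀ (l : List ℕ) (k : ℕ), l.foldl (fun acc a => max acc a) k = max k (l.foldr max 0) := by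
    intro l; induction l with
    | nil => intro k; simp
    | cons a l ih => intro k; rw [List.foldl_cons, ih, List.foldr_cons, max_assoc]
  have h := foldl₀ (step := fun (a : ℕ) acc => max acc a) (b₀ := 0) hstep X (fun l₁ l₂ => by
    rw [hfold, Nat.zero_max, length_unE, eval_X]
    refine foldr_max_le fun x hx => ?_
    have := length_item_le_length_rawE unE (List.mem_append_left l₂ hx)
    rw [length_unE] at this; omega)
  exact h.congr fun l => by rw [hfold, Nat.zero_max]

/-! ### The parameters on codes -/

/-- `n` (unary). [folklore] -/
theorem codeFP_nT : CodeFP toE unE nT := (ulength unE).comp codeFP_wt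

/-- `ν` (unary). [folklore] -/
theorem codeFP_νT : CodeFP toE unE νT := (ulength fE).comp codeFP_keptT

/-- The size measure (unary). [folklore] -/
theorem codeFP_sizeOfT : CodeFP toE unE sizeOfT := by
  have h : CodeFP toE unE (fun t => t.2.2.1.length + t.2.1.length + t.2.2.1.sum) :=
    (unAdd.comp ((unAdd.comp (codeFP_nT.pair ((ulength fE).comp codeFP_formulasRaw))).pair (unSum.comp codeFP_wt)) :)
  exact h.congr fun t => by unfold sizeOfT; rfl

/-- `⌊log₂ x⌋` in unary for a unary `x`. [folklore] -/
theorem unLog2 : CodeFP unE unE (fun x => Nat.log 2 x) := by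
  have h : CodeFP unE natE (fun x => min (List.replicate x ()).length (Nat.log 2 x)) :=
    (natLog2Min.comp (natOfUn.pair replicateUnit) :)
  have h' : CodeFP unE natE (fun x => Nat.log 2 x) := h.congr fun x => by
    rw [List.length_replicate]; exact min_eq_right (Nat.log_le_self 2 x)
  exact unOfNatCap h' (CodeFP.id unE) fun x => Nat.log_le_self 2 x

/-- `Λ` (unary). [folklore] -/
theorem codeFP_logLamT : CodeFP toE unE logLamT := by
  have hl : CodeFP toE unE (fun t => Nat.log 2 (sizeOfT t) + 1) := (unSucc.comp (unLog2.comp codeFP_sizeOfT) :)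
  have h2 : CodeFP toE unE (fun t => (Nat.log 2 (sizeOfT t) + 1) + (Nat.log 2 (sizeOfT t) + 1)) := (unAdd.comp (hl.pair hl) :)
  have h4 := unAdd.comp (h2.pair h2)
  have h : CodeFP toE unE (fun t => (Nat.log 2 (sizeOfT t) + 1) + (Nat.log 2 (sizeOfT t) + 1) +
      ((Nat.log 2 (sizeOfT t) + 1) + (Nat.log 2 (sizeOfT t) + 1)) + 4096) := unAdd.comp (h4.pair (const toE 4096))
  exact h.congr fun t => by unfold logLamT; omega

/-- `λ` (binary). [folklore] -/
theorem codeFP_lamT : CodeFP toE natE lamT := by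
  have h : CodeFP toE natE (fun t => 2 ^ logLamT t) := (natPow.comp ((const toE (2 : ℕ)).pair codeFP_logLamT) :)
  exact h.congr fun t => by unfold lamT; rfl

/-- `Lj` (unary). [folklore] -/
theorem codeFP_LjT : CodeFP toE unE LjT := unSucc.comp (unLog2.comp codeFP_νT)

/-- `Δ ≤ n` on tuples. [folklore] -/
theorem ΔT_le_nT (t : TO) : ΔT t ≤ nT t :=
  (Nat.sqrt_le_self _).trans (min_le_left _ _)

/-- `Δ` (unary). [folklore] -/
theorem codeFP_ΔTun : CodeFP toE unE ΔT := unOfNatCap codeFP_ΔT codeFP_nT ΔT_le_nT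

/-- `k_A` (unary). [folklore] -/
theorem codeFP_kAT : CodeFP toE unE kAT := by
  have h : CodeFP toE unE (fun t => 96 * (ΔT t * ΔT t)) :=
    (unMul.comp ((const toE (96 : ℕ)).pair (unMul.comp (codeFP_ΔTun.pair codeFP_ΔTun))) :)
  exact h.congr fun t => by unfold kAT; rfl

/-- `m` (unary). [folklore] -/
theorem codeFP_mIT : CodeFP toE unE mIT := unSucc.comp (unLog2.comp codeFP_kAT)

/-- `⌊log₂ (max(1, a) · 2^Λ)⌋ + 1` in unary from unary `a` and `Λ`. [folklore] -/
theorem unLogMulPow : CodeFP (pairE unE unE) unE (fun p => Nat.log 2 (max 1 p.1 * 2 ^ p.2) + 1) := by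
  have hx : CodeFP (pairE unE unE) natE (fun p => max 1 p.1 * 2 ^ p.2) :=
    (natMul.comp ((natMax.comp ((const _ (1 : ℕ)).pair (natOfUn.comp (fst unE unE)))).pair (natPow.comp ((const _ (2 : ℕ)).pair (snd unE unE)))) :)
  -- budget `a + Λ + 1` units dominate the logarithm
  have hb : CodeFP (pairE unE unE) unE (fun p => p.1 + p.2 + 1) := (unSucc.comp (unAdd.comp ((fst unE unE).pair (snd unE unE))) :)
  have hlog_le : ∀ p : ℕ × ℕ, Nat.log 2 (max 1 p.1 * 2 ^ p.2) ≤ p.1 + p.2 + 1 := by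
    intro p
    have h1 : max 1 p.1 < 2 ^ (p.1 + 1) := by
      rcases Nat.eq_zero_or_pos p.1 with h | h
      · rw [h]; norm_num
      · rw [max_eq_right h]; exact (Nat.lt_two_pow_self).trans (Nat.pow_lt_pow_right (by norm_num) (by omega))
    have h2 : max 1 p.1 * 2 ^ p.2 < 2 ^ (p.1 + p.2 + 1) := by
      calc max 1 p.1 * 2 ^ p.2 < 2 ^ (p.1 + 1) * 2 ^ p.2 := Nat.mul_lt_mul_of_pos_right h1 (Nat.two_pow_pos _)
        _ = 2 ^ (p.1 + p.2 + 1) := by rw [← pow_add]; ring_nf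
    exact (Nat.log_lt_of_lt_pow (by positivity) h2).le
  have hl : CodeFP (pairE unE unE) natE (fun p => min (List.replicate (p.1 + p.2 + 1) ()).length (Nat.log 2 (max 1 p.1 * 2 ^ p.2))) :=
    (natLog2Min.comp (hx.pair (replicateUnit.comp hb)) :)
  have hl' : CodeFP (pairE unE unE) natE (fun p => Nat.log 2 (max 1 p.1 * 2 ^ p.2)) := hl.congr fun p => by
    rw [List.length_replicate]; exact min_eq_right (hlog_le p)
  exact unSucc.comp (unOfNatCap hl' hb hlog_le)

/-- `N_k` (unary) from the tuple and `k` (binary). [folklore] -/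
theorem codeFP_NT : CodeFP (pairE toE natE) unE (fun p => NT p.1 p.2) := by
  have h : CodeFP (pairE toE natE) unE (fun p => Nat.log 2 (max 1 (wT p.1 p.2) * 2 ^ logLamT p.1) + 1) :=
    (unLogMulPow.comp (codeFP_wT.pair (codeFP_logLamT.comp (fst _ _))) :)
  exact h.congr fun p => by unfold NT lamT; rfl

/-- `Nbig` (unary). [folklore] -/
theorem codeFP_NbigT : CodeFP toE unE NbigT := by
  have h : CodeFP toE unE (fun t => Nat.log 2 (max 1 (t.2.2.1.foldr max 0) * 2 ^ logLamT t) + 1) :=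
    (unLogMulPow.comp ((unMaxList.comp codeFP_wt).pair codeFP_logLamT) :)
  exact h.congr fun t => by unfold NbigT lamT; rfl

/-- `ℓ` (unary). [folklore] -/
theorem codeFP_ℓT : CodeFP toE unE ℓT := by
  have hz : CodeFP toE bitE (fun t => decide (nT t = 0)) :=
    ((natEq.comp ((natOfUn.comp codeFP_nT).pair (const toE (0 : ℕ)))) :)
  have h16 : CodeFP toE unE (fun t => NbigT t * 4 ^ 2) := (unMul.comp (codeFP_NbigT.pair (const toE (4 ^ 2 : ℕ))) :)
  have hrest : CodeFP toE unE (fun t => (NbigT t + mIT t) + NbigT t) :=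
    (unAdd.comp ((unAdd.comp (codeFP_NbigT.pair codeFP_mIT)).pair codeFP_NbigT) :)
  have h : CodeFP toE unE (fun t => if decide (nT t = 0) then 0 else NbigT t * 4 ^ 2 + ((NbigT t + mIT t) + NbigT t)) :=
    (hz.ite (const toE 0) (unAdd.comp (h16.pair hrest)) :)
  exact h.congr fun t => by
    unfold ℓT
    by_cases h : nT t = 0
    · rw [if_pos h, if_pos (decide_eq_true h)]
    · rw [if_neg h, if_neg (by simpa using h)]

/-- `d = ℓ · 4^{140}` (unary). [folklore] -/
theorem codeFP_dNWT : CodeFP toE unE dNWT := by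
  have h : CodeFP toE unE (fun t => ℓT t * 4 ^ 140) := (unMul.comp (codeFP_ℓT.pair (const toE (4 ^ 140 : ℕ))) :)
  exact h.congr fun t => by unfold dNWT; rfl

/-- `Lx` (unary). [folklore] -/
theorem codeFP_LxT : CodeFP toE unE LxT := by
  have h : CodeFP toE unE (fun t => LjT t + (dNWT t + ΔT t * ΔT t)) :=
    (unAdd.comp (codeFP_LjT.pair (unAdd.comp (codeFP_dNWT.pair (unMul.comp (codeFP_ΔTun.pair codeFP_ΔTun))))) :)
  exact h.congr fun t => by unfold LxT; rfl

/-- `s_P` (binary). [folklore] -/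
theorem codeFP_sPT : CodeFP toE natE sPT := by
  have hlam := codeFP_lamT
  have hθ := codeFP_θ
  have hΛ : CodeFP toE natE (fun t => logLamT t) := (natOfUn.comp codeFP_logLamT :)
  have hn : CodeFP toE natE (fun t => nT t) := (natOfUn.comp codeFP_nT :)
  have hΔ : CodeFP toE natE ΔT := (codeFP_ΔT :)
  have hkA : CodeFP toE natE (fun t => kAT t) := (natOfUn.comp codeFP_kAT :)
  have hNbig : CodeFP toE natE (fun t => NbigT t) := (natOfUn.comp codeFP_NbigT :)
  have hmI : CodeFP toE natE (fun t => mIT t) := (natOfUn.comp codeFP_mIT :)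
  have hLj : CodeFP toE natE (fun t => LjT t) := (natOfUn.comp codeFP_LjT :)
  have hν : CodeFP toE natE (fun t => νT t) := (natOfUn.comp codeFP_νT :)
  have t1 : CodeFP toE natE (fun t => 320 * lamT t * t.2.2.2 / logLamT t) :=
    (natDiv.comp ((natMul.comp ((natMul.comp ((const toE (320 : ℕ)).pair hlam)).pair hθ)).pair hΛ) :)
  have t2a : CodeFP toE natE (fun t => ΔT t * kAT t * (NbigT t * (2 * mIT t + 3))) :=
    (natMul.comp ((natMul.comp (hΔ.pair hkA)).pair (natMul.comp (hNbig.pair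
      (natAdd.comp ((natMul.comp ((const toE (2 : ℕ)).pair hmI)).pair (const toE (3 : ℕ))))))) :)
  have t2b : CodeFP toE natE (fun t => ΔT t * (kAT t + 1)) := (natMul.comp (hΔ.pair (natAdd.comp (hkA.pair (const toE (1 : ℕ))))) :)
  have t2 : CodeFP toE natE (fun t => nT t * (ΔT t * kAT t * (NbigT t * (2 * mIT t + 3)) + ΔT t * (kAT t + 1))) :=
    (natMul.comp (hn.pair (natAdd.comp (t2a.pair t2b))) :)
  have t3a : CodeFP toE natE (fun t => 2 ^ (LjT t + 1) - 1) :=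
    (natSub.comp ((natPow.comp ((const toE (2 : ℕ)).pair (unSucc.comp codeFP_LjT))).pair (const toE (1 : ℕ))) :)
  have t3b : CodeFP toE natE (fun t => νT t * (2 * ΔT t + 1)) :=
    (natMul.comp (hν.pair (natAdd.comp ((natMul.comp ((const toE (2 : ℕ)).pair hΔ)).pair (const toE (1 : ℕ))))) :)
  have t3c : CodeFP toE natE (fun t => 2 * νT t + 1) := (natAdd.comp ((natMul.comp ((const toE (2 : ℕ)).pair hν)).pair (const toE (1 : ℕ))) :)
  have t3 : CodeFP toE natE (fun t => (2 ^ (LjT t + 1) - 1) + νT t * (2 * ΔT t + 1) + (2 * νT t + 1)) :=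
    (natAdd.comp ((natAdd.comp (t3a.pair t3b)).pair t3c) :)
  have h : CodeFP toE natE (fun t => 320 * lamT t * t.2.2.2 / logLamT t +
      nT t * (ΔT t * kAT t * (NbigT t * (2 * mIT t + 3)) + ΔT t * (kAT t + 1)) +
      ((2 ^ (LjT t + 1) - 1) + νT t * (2 * ΔT t + 1) + (2 * νT t + 1))) :=
    natAdd.comp ((natAdd.comp (t1.pair t2)).pair t3)
  exact h.congr fun t => by unfold sPT; rfl

/-- The coin offset `Σ_{k' < min k n} 2^{N_{k'}}` (binary) from the tuple and `k` (binary); this is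
`offT t k` for `k ≤ n`. [folklore] -/
theorem codeFP_offT : CodeFP (pairE toE natE) natE (fun p => offT p.1 (min p.2 (nT p.1))) := by
  have hrange : CodeFP (pairE toE natE) (rawE natE) (fun p => List.range (min p.2 (nT p.1))) :=
    (rangeOf.comp ((codeFP_nT.comp (fst _ _)).pair (snd _ _)) :)
  have hitem : CodeFP (pairE toE natE) natE (fun p => 2 ^ NT p.1 p.2) := (natPow.comp ((const _ (2 : ℕ)).pair codeFP_NT) :)
  have hmap : CodeFP (pairE toE (rawE natE)) (rawE natE) (fun p => p.2.map fun k' => 2 ^ NT p.1 k') :=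
    (map (σ := TO) (eσ := toE) hitem :)
  have h : CodeFP (pairE toE natE) natE (fun p => ((List.range (min p.2 (nT p.1))).map fun k' => 2 ^ NT p.1 k').sum) :=
    (natSum.comp (hmap.comp ((fst _ _).pair hrange)) :)
  exact h.congr fun p => by unfold offT; rfl

end HiraharaMachine

end Literature.Computability.Complexity
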